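import Mathlib
import Summits.CriticalPhenomena.Ising3DConformalLimit.Theorems.EnergyNotSigmaSquaredMoebiusLimitExistsDefs
import Summits.CriticalPhenomena.Ising3DConformalLimit.Theorems.MarkovRigidityFieldRealisationMomentLimit
import Literature.MathematicalPhysics.QuantumFieldTheory.ContinuumLimitsTrivialityAssemblyProofs
import Literature.MathematicalPhysics.QuantumFieldTheory.ContinuumLimitsPhi4WickProofs
import Literature.Probability.LatticeModels.HighDimTriviality
import Literature.MathematicalPhysics.QuantumLattice.RandomField
import HarnessLib

/-!
# Crux `GaussianLimitIsFree` (item stmt-CriticalPhenomena-2601), line `registered` (birth v2):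
# stub `stub_newmanGaussianity` — the law realising the generalised-free-field family is Gaussian

A probability law `μ` on `𝒮'(ℝ³)` with all moments, all exponential moments and moment densities
`(√A)ⁿ · W_Δ` (`W_Δ = wickPower Δ`, the normalised Wick family of the kernel `‖p − q‖^{-2Δ}`;
`A > 0`, `1/2 ≤ Δ ≤ 1`) is a centred Gaussian field.

Proof.
* **Smeared Wick moments** (continuum analogue of `sum_prod_mul_pairingSum`): for a Schwartz `f`,
  `∫_{(ℝ³)^{2m}} 𝒢_m[K](x) ∏ᵢ f(xᵢ) dx = (2m)!/(2ᵐ m!) · Cᵐ`, `C = ∫∫ f(p) f(q) K(p,q)`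
  (`integral_prod_mul_pairingSum`: expand the average over orderings, relabel the coordinates —
  `volume_measurePreserving_piCongrLeft` — and integrate the product over disjoint pairs of
  coordinates, `integral_pairProd`, peeling off the first pair with
  `volume_preserving_piFinSuccAbove`).  The coincident configurations are Lebesgue-null
  (`ae_mem_nonCoincident`), so the normalisation inside `wickPower` is invisible; odd orders
  vanish.  Hence `E[ω(f)^{2m}] = (2m)!/(2ᵐ m!) Vᵐ` with `V = E[ω(f)²] = A·C ≥ 0` and
  `E[ω(f)^{2m+1}] = 0`.
* **Gaussian marginals**: all exponential moments of `ω(f)` are finite (`exp (ω (t • f))` is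
  integrable for every `t`), so `E[e^{zω(f)}] = Σ zᵏ E[ω(f)ᵏ]/k! = e^{z²V/2}` (the tree's summation
  step `abs_mgf_sub_exp_le_of_wickMoment_bounds_of_integrable_exp` with zero Wick deviation), and a
  law with this moment generating function is `N(0,V)` (`eq_gaussianReal_of_mgf_eq`, Mathlib's
  `Measure.ext_of_complexMGF_eq`).
* Gaussian marginals make `μ` Gaussian (`isGaussian_of_map_eval_eq_gaussianReal`); it is centred
  because the first moments vanish.

References: Glimm–Jaffe 1987 §6.1–6.2; Newman 1975 (Gaussian domination ⇒ exponential moments);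
Aizenman–Duminil-Copin 2021 §6.3 (summation step).  No definitions are introduced.
-/

noncomputable section

namespace Summit.CriticalPhenomena.Ising3DConformalLimit.Cruxes.GaussianLimitIsFree.Birth

open MeasureTheory Literature.Probability.LatticeModels
  Literature.MathematicalPhysics.QuantumLattice
open Summit.CriticalPhenomena.Ising3DConformalLimit.MoebiusLimitExistsOnlyInteraction
open Summit.CriticalPhenomena.Ising3DConformalLimit.MarkovRigidityFieldRealisation
open scoped Nat ENNReal

namespace Newman

/-! ### Integrals of products over disjoint pairs of coordinates -/

/-- **Fubini over disjoint pairs.**  For every two-point function `h` on `ℝ³ × ℝ³`,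
`∫_{(ℝ³)^{2m}} ∏_{j<m} h(y_{2j}, y_{2j+1}) dy = (∫ h)ᵐ` (induction on `m`: the first two
coordinates are split off with `volume_preserving_piFinSuccAbove` and separated by
`integral_prod_mul`; no integrability is needed). [folklore] -/
theorem integral_pairProd (h : EuclideanSpace ℝ (Fin 3) × EuclideanSpace ℝ (Fin 3) → ℝ) :
    ∀ m : ℕ, ∫ y : Fin (2 * m) → EuclideanSpace ℝ (Fin 3),
      ∏ j : Fin m, h (y (pairIdx m (j, 0)), y (pairIdx m (j, 1))) = (∫ z, h z) ^ m
  | 0 => by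
    have hE : IsEmpty (Fin (2 * 0)) := by rw [Nat.mul_zero]; infer_instance
    simp only [Finset.univ_eq_empty, Finset.prod_empty, pow_zero]
    rw [integral_const, smul_eq_mul, mul_one, measureReal_def, volume_pi, Measure.pi_empty_univ,
      ENNReal.toReal_one]
  | m + 1 => by
    have ih := integral_pairProd h m
    -- the integrand after splitting off the coordinates `0` and `1`
    set G'' : (EuclideanSpace ℝ (Fin 3) × EuclideanSpace ℝ (Fin 3)) ×
        (Fin (2 * m) → EuclideanSpace ℝ (Fin 3)) → ℝ := fun q =>
      h q.1 * ∏ j : Fin m, h (q.2 (pairIdx m (j, 0)), q.2 (pairIdx m (j, 1))) with hG''def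
    -- reassociate: `G' (a, (b, r)) = h (a, b) * ∏ⱼ h (r_{2j}, r_{2j+1})`
    set G' : EuclideanSpace ℝ (Fin 3) × (EuclideanSpace ℝ (Fin 3) ×
        (Fin (2 * m) → EuclideanSpace ℝ (Fin 3))) → ℝ :=
      G'' ∘ (MeasurableEquiv.prodAssoc).symm with hG'def
    -- peel coordinate `0` of the tail: `G (a, g) = G' (a, (g 0, g ∘ succ))`
    set e1 := MeasurableEquiv.piFinSuccAbove (fun _ : Fin (2 * m + 1) => EuclideanSpace ℝ (Fin 3)) 0
      with he1
    have he1mp : MeasurePreserving e1 :=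
      volume_preserving_piFinSuccAbove (fun _ : Fin (2 * m + 1) => EuclideanSpace ℝ (Fin 3)) 0
    set G : EuclideanSpace ℝ (Fin 3) × (Fin (2 * m + 1) → EuclideanSpace ℝ (Fin 3)) → ℝ :=
      G' ∘ Prod.map id e1 with hGdef
    -- peel coordinate `0`: the pair product is `G ∘ e0`
    set e0 := MeasurableEquiv.piFinSuccAbove (fun _ : Fin (2 * m + 2) => EuclideanSpace ℝ (Fin 3)) 0
      with he0
    have he0mp : MeasurePreserving e0 :=
      volume_preserving_piFinSuccAbove (fun _ : Fin (2 * m + 2) => EuclideanSpace ℝ (Fin 3)) 0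
    have key : (fun y : Fin (2 * (m + 1)) → EuclideanSpace ℝ (Fin 3) =>
        ∏ j : Fin (m + 1), h (y (pairIdx (m + 1) (j, 0)), y (pairIdx (m + 1) (j, 1)))) = G ∘ e0 := by
      funext y
      rw [pairProd_succ]
      simp [hGdef, hG'def, hG''def, he0, he1, MeasurableEquiv.piFinSuccAbove_apply,
        MeasurableEquiv.prodAssoc, Fin.tail]
    calc ∫ y : Fin (2 * (m + 1)) → EuclideanSpace ℝ (Fin 3),
          ∏ j : Fin (m + 1), h (y (pairIdx (m + 1) (j, 0)), y (pairIdx (m + 1) (j, 1)))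
        = ∫ y, G (e0 y) := by rw [key]; rfl
      _ = ∫ q, G q := he0mp.integral_comp' G
      _ = ∫ q, G' q ∂(volume.prod volume) :=
          ((MeasurePreserving.id (volume : Measure (EuclideanSpace ℝ (Fin 3)))).prod
            he1mp).integral_comp ((MeasurableEmbedding.id).prodMap e1.measurableEmbedding) G'
      _ = ∫ q, G'' q := (volume_preserving_prodAssoc.symm MeasurableEquiv.prodAssoc).integral_comp' G''
      _ = (∫ z, h z) * ∫ r : Fin (2 * m) → EuclideanSpace ℝ (Fin 3),
            ∏ j : Fin m, h (r (pairIdx m (j, 0)), r (pairIdx m (j, 1))) :=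
          integral_prod_mul (μ := volume) (ν := volume) h
            fun r : Fin (2 * m) → EuclideanSpace ℝ (Fin 3) =>
              ∏ j : Fin m, h (r (pairIdx m (j, 0)), r (pairIdx m (j, 1)))
      _ = (∫ z, h z) ^ (m + 1) := by rw [ih, pow_succ']

/-! ### Smearing the pairing functional -/

/-- **Smearing Wick's law in the continuum** (the continuum analogue of `sum_prod_mul_pairingSum`):
for a one-point weight `g` and a kernel `K` with `g ⊗ g · K` integrable on `ℝ³ × ℝ³`,
`∫_{(ℝ³)^{2m}} (∏ᵢ g(xᵢ)) 𝒢_m[K](x) dx = (2m)!/(2ᵐ m!) · (∫∫ g(p) g(q) K(p,q))ᵐ`: expand the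
average over the `(2m)!` orderings, relabel the coordinates (`volume_measurePreserving_piCongrLeft`),
regroup the weights along the pairs (`prod_eq_prod_pairs`) and apply `integral_pairProd`. [folklore] -/
theorem integral_prod_mul_pairingSum (g : EuclideanSpace ℝ (Fin 3) → ℝ)
    (K : EuclideanSpace ℝ (Fin 3) → EuclideanSpace ℝ (Fin 3) → ℝ)
    (hint : Integrable fun z : EuclideanSpace ℝ (Fin 3) × EuclideanSpace ℝ (Fin 3) =>
      g z.1 * g z.2 * K z.1 z.2) (m : ℕ) :
    ∫ x : Fin (2 * m) → EuclideanSpace ℝ (Fin 3), (∏ i, g (x i)) * pairingSum K m x =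
      ((2 * m)! : ℝ) / (2 ^ m * m !) *
        (∫ z : EuclideanSpace ℝ (Fin 3) × EuclideanSpace ℝ (Fin 3), g z.1 * g z.2 * K z.1 z.2) ^ m := by
  set h : EuclideanSpace ℝ (Fin 3) × EuclideanSpace ℝ (Fin 3) → ℝ := fun z =>
    g z.1 * g z.2 * K z.1 z.2 with hh
  -- the pair product and its relabellings
  set T : (Fin (2 * m) → EuclideanSpace ℝ (Fin 3)) → ℝ := fun y =>
    ∏ j : Fin m, h (y (pairIdx m (j, 0)), y (pairIdx m (j, 1))) with hT
  have hTint : Integrable T := integrable_pairProd hint m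
  have hTI : ∫ y, T y = (∫ z, h z) ^ m := integral_pairProd h m
  have hτ : ∀ τ : Equiv.Perm (Fin (2 * m)),
      Integrable (fun x : Fin (2 * m) → EuclideanSpace ℝ (Fin 3) => T (x ∘ τ)) ∧
        ∫ x : Fin (2 * m) → EuclideanSpace ℝ (Fin 3), T (x ∘ τ) = (∫ z, h z) ^ m := by
    intro τ
    have hmp := volume_measurePreserving_piCongrLeft
      (fun _ : Fin (2 * m) => EuclideanSpace ℝ (Fin 3)) τ.symm
    have hcomp : (fun x : Fin (2 * m) → EuclideanSpace ℝ (Fin 3) => T (x ∘ τ)) =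
        T ∘ (MeasurableEquiv.piCongrLeft (fun _ : Fin (2 * m) => EuclideanSpace ℝ (Fin 3)) τ.symm) := by
      funext x
      simp only [Function.comp_apply, MeasurableEquiv.coe_piCongrLeft]
      congr 1
      funext i
      rw [Function.comp_apply, Equiv.piCongrLeft_apply_eq_cast, cast_eq, Equiv.symm_symm]
    rw [hcomp]
    refine ⟨(hmp.integrable_comp_emb (MeasurableEquiv.measurableEmbedding _)).2 hTint, ?_⟩
    rw [← hTI]
    exact hmp.integral_comp' T
  -- expand the pairing functional
  have hexp : (fun x : Fin (2 * m) → EuclideanSpace ℝ (Fin 3) => (∏ i, g (x i)) * pairingSum K m x) =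
      fun x => ((2 : ℝ) ^ m * m !)⁻¹ * ∑ τ : Equiv.Perm (Fin (2 * m)), T (x ∘ τ) := by
    funext x
    rw [pairingSum, mul_left_comm, Finset.mul_sum]
    congr 1
    refine Finset.sum_congr rfl fun τ _ => ?_
    rw [prod_eq_prod_pairs g m x τ, hT]
    simp only [Function.comp_apply, hh]
    rw [← Finset.prod_mul_distrib]
  rw [hexp, integral_const_mul, integral_finsetSum _ fun τ _ => (hτ τ).1,
    Finset.sum_congr rfl fun τ _ => (hτ τ).2, Finset.sum_const, Finset.card_univ,
    Fintype.card_perm, Fintype.card_fin, nsmul_eq_mul]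
  rw [hh]
  ring

/-! ### The smeared generalised free field -/

/-- For a Schwartz `f` and `0 ≤ Δ < 3/2`, `(p,q) ↦ f(p) f(q) ‖p − q‖^{-2Δ}` is integrable on
`ℝ³ × ℝ³` (Schwartz decay `|f(p)| ≤ B(1+‖p‖)^{-4}`, `abs_le_seminorm_mul_weight`, and
`integrable_weight_mul_kernel`: local integrability of `‖u‖^{-2Δ}`, `2Δ < 3`). [folklore] -/
theorem integrable_smear_powerKernel (f : SchwartzMap (EuclideanSpace ℝ (Fin 3)) ℝ) {Δ : ℝ}
    (hΔ0 : 0 ≤ Δ) (hΔ : Δ < 3 / 2) :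
    Integrable fun z : EuclideanSpace ℝ (Fin 3) × EuclideanSpace ℝ (Fin 3) =>
      f z.1 * f z.2 * powerKernel Δ z.1 z.2 := by
  set B : ℝ := 2 ^ 4 * ((Finset.Iic ((4, 0) : ℕ × ℕ)).sup
    (schwartzSeminormFamily ℝ (EuclideanSpace ℝ (Fin 3)) ℝ)) f with hB
  have hB0 : 0 ≤ B := by positivity
  have hf : ∀ p, |f p| ≤ B * (1 + ‖p‖) ^ (-(4 : ℝ)) := abs_le_seminorm_mul_weight f
  have hdom := integrable_weight_mul_kernel (a := 2 * Δ) (N := 4) (by linarith) (by linarith)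
    (by norm_num)
  refine (hdom.const_mul (B * B)).mono' ?_ (Filter.Eventually.of_forall fun z => ?_)
  · refine Measurable.aestronglyMeasurable ?_
    refine ((f.continuous.measurable.comp measurable_fst).mul
      (f.continuous.measurable.comp measurable_snd)).mul ?_
    exact (measurable_fst.sub measurable_snd).norm.pow_const _
  · have hk0 : 0 ≤ ‖z.1 - z.2‖ ^ (-(2 * Δ)) := Real.rpow_nonneg (norm_nonneg _) _
    have hw1 : 0 ≤ B * (1 + ‖z.1‖) ^ (-(4 : ℝ)) := mul_nonneg hB0 (weight_nonneg 4 _)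
    have hw2 : 0 ≤ B * (1 + ‖z.2‖) ^ (-(4 : ℝ)) := mul_nonneg hB0 (weight_nonneg 4 _)
    rw [Real.norm_eq_abs, abs_mul, abs_mul, powerKernel, abs_of_nonneg hk0]
    calc |f z.1| * |f z.2| * ‖z.1 - z.2‖ ^ (-(2 * Δ))
        ≤ (B * (1 + ‖z.1‖) ^ (-(4 : ℝ))) * (B * (1 + ‖z.2‖) ^ (-(4 : ℝ))) *
            max 1 (‖z.1 - z.2‖ ^ (-(2 * Δ))) :=
          mul_le_mul (mul_le_mul (hf _) (hf _) (abs_nonneg _) hw1) (le_max_right _ _) hk0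
            (mul_nonneg hw1 hw2)
      _ = B * B * ((1 + ‖z.1‖) ^ (-(4 : ℝ)) * (1 + ‖z.2‖) ^ (-(4 : ℝ)) *
            max 1 (‖z.1 - z.2‖ ^ (-(2 * Δ)))) := by ring

/-- **Even smeared moments of the generalised free field are Wick**: for a Schwartz `f`,
`0 ≤ Δ < 3/2` and `A ≥ 0`,
`∫_{(ℝ³)^{2m}} (√A)^{2m} W_Δ(x) ∏ᵢ f(xᵢ) dx = (2m)!/(2ᵐ m!) · (A ∫∫ f(p) f(q) ‖p−q‖^{-2Δ})ᵐ`
(`W_Δ = 𝒢_m[‖·−·‖^{-2Δ}]` off the Lebesgue-null coincident set, `ae_mem_nonCoincident`).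
[folklore] -/
theorem integral_gff_even (f : SchwartzMap (EuclideanSpace ℝ (Fin 3)) ℝ) {Δ : ℝ} (hΔ0 : 0 ≤ Δ)
    (hΔ : Δ < 3 / 2) {A : ℝ} (hA : 0 ≤ A) (m : ℕ) :
    ∫ x : Fin (2 * m) → EuclideanSpace ℝ (Fin 3),
        (Real.sqrt A ^ (2 * m) * wickPower Δ (2 * m) x) * ∏ i, f (x i) =
      ((2 * m)! : ℝ) / (2 ^ m * m !) *
        (A * ∫ z : EuclideanSpace ℝ (Fin 3) × EuclideanSpace ℝ (Fin 3),
          f z.1 * f z.2 * powerKernel Δ z.1 z.2) ^ m := by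
  have hae : (fun x : Fin (2 * m) → EuclideanSpace ℝ (Fin 3) =>
      (Real.sqrt A ^ (2 * m) * wickPower Δ (2 * m) x) * ∏ i, f (x i)) =ᵐ[volume]
      fun x => Real.sqrt A ^ (2 * m) * ((∏ i, f (x i)) * pairingSum (powerKernel Δ) m x) := by
    filter_upwards [ae_mem_nonCoincident (2 * m)] with x hx
    rw [wickPower_of_mem_even hx]
    ring
  rw [integral_congr_ae hae, integral_const_mul,
    integral_prod_mul_pairingSum _ _ (integrable_smear_powerKernel f hΔ0 hΔ) m, pow_mul,
    Real.sq_sqrt hA, mul_pow]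
  ring

/-- **Odd smeared moments of the generalised free field vanish** (`W_Δ` is zero at odd orders,
`wickPower_of_odd`). [folklore] -/
theorem integral_gff_odd (f : SchwartzMap (EuclideanSpace ℝ (Fin 3)) ℝ) (Δ A : ℝ) (m : ℕ) :
    ∫ x : Fin (2 * m + 1) → EuclideanSpace ℝ (Fin 3),
      (Real.sqrt A ^ (2 * m + 1) * wickPower Δ (2 * m + 1) x) * ∏ i, f (x i) = 0 := by
  have h0 : (fun x : Fin (2 * m + 1) → EuclideanSpace ℝ (Fin 3) =>
      (Real.sqrt A ^ (2 * m + 1) * wickPower Δ (2 * m + 1) x) * ∏ i, f (x i)) = fun _ => 0 := by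
    funext x
    rw [wickPower_of_odd (odd_two_mul_add_one m) x, mul_zero, zero_mul]
  rw [h0, integral_zero]

end Newman

/-! ### The stub -/

/-- **Stub 1 (Gaussianity of the realised law; lattice-free).** A probability law `μ` on `𝒮'(ℝ³)`
with all moments, all exponential moments and moment densities `(√A)ⁿ · W_Δ` (`W_Δ = wickPower Δ`,
the normalised Wick family of `‖p−q‖^{-2Δ}`; `A > 0`, `1/2 ≤ Δ ≤ 1`) is a centred Gaussian field:
every marginal `ω f` has the moments of `N(0, A∫∫ f(x)‖x−y‖^{-2Δ}f(y))` (`Newman.integral_gff_even`,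
`Newman.integral_gff_odd`) and all exponential moments, hence that moment generating function (zero
Wick deviation in `abs_mgf_sub_exp_le_of_wickMoment_bounds_of_integrable_exp`) and is that normal
law (`eq_gaussianReal_of_mgf_eq`, Mathlib `Measure.ext_of_complexMGF_eq`); Gaussian marginals make
`μ` Gaussian (`isGaussian_of_map_eval_eq_gaussianReal`), and the vanishing first moments make it
centred. [folklore] -/
theorem stub_newmanGaussianity :
    ∀ (Δ A : ℝ)
      (μ : MeasureTheory.Measure (Literature.MathematicalPhysics.QuantumLattice.FieldConfig (EuclideanSpace ℝ (Fin 3)))),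
      0 < A → 1 / 2 ≤ Δ → Δ ≤ 1 →
      MeasureTheory.IsProbabilityMeasure μ →
      Literature.MathematicalPhysics.QuantumLattice.HasAllMoments μ →
      (∀ f : SchwartzMap (EuclideanSpace ℝ (Fin 3)) ℝ, MeasureTheory.Integrable (fun ω : Literature.MathematicalPhysics.QuantumLattice.FieldConfig (EuclideanSpace ℝ (Fin 3)) => Real.exp (ω f)) μ) →
      (∀ (n : ℕ) (f : Fin n → SchwartzMap (EuclideanSpace ℝ (Fin 3)) ℝ), Literature.MathematicalPhysics.QuantumLattice.moment μ n f = ∫ x : Fin n → EuclideanSpace ℝ (Fin 3), (Real.sqrt A ^ n * Summit.CriticalPhenomena.Ising3DConformalLimit.MoebiusLimitExistsOnlyInteraction.wickPower Δ n x) * ∏ i, f i (x i)) →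
      Literature.MathematicalPhysics.QuantumLattice.IsGaussianField μ := by
  intro Δ A μ hA hΔ1 hΔ2 hP hall hexp hmom
  have hΔ0 : 0 ≤ Δ := by linarith
  have hΔ3 : Δ < 3 / 2 := by linarith
  -- the power moments of a marginal are the smeared moment densities
  have hpow : ∀ (f : SchwartzMap (EuclideanSpace ℝ (Fin 3)) ℝ) (n : ℕ),
      ∫ ω : FieldConfig (EuclideanSpace ℝ (Fin 3)), (ω f) ^ n ∂μ =
        ∫ x : Fin n → EuclideanSpace ℝ (Fin 3), (Real.sqrt A ^ n * wickPower Δ n x) * ∏ i, f (x i) := by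
    intro f n
    rw [← hmom n (fun _ => f), Literature.MathematicalPhysics.QuantumLattice.moment]
    refine integral_congr_ae (Filter.Eventually.of_forall fun ω => ?_)
    simp only [Fin.prod_const]
  -- the variance of a marginal
  set V : SchwartzMap (EuclideanSpace ℝ (Fin 3)) ℝ → ℝ := fun f =>
    ∫ ω : FieldConfig (EuclideanSpace ℝ (Fin 3)), (ω f) ^ 2 ∂μ with hVdef
  have hV : ∀ f : SchwartzMap (EuclideanSpace ℝ (Fin 3)) ℝ,
      V f = A * ∫ z : EuclideanSpace ℝ (Fin 3) × EuclideanSpace ℝ (Fin 3),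
        f z.1 * f z.2 * powerKernel Δ z.1 z.2 := by
    intro f
    have h := hpow f (2 * 1)
    rw [Newman.integral_gff_even f hΔ0 hΔ3 hA.le 1] at h
    simp only [mul_one, pow_one, Nat.factorial] at h
    rw [hVdef]
    simp only
    rw [h]
    norm_num
  have hV0 : ∀ f : SchwartzMap (EuclideanSpace ℝ (Fin 3)) ℝ, 0 ≤ V f := fun f =>
    integral_nonneg fun ω => sq_nonneg _
  -- Wick's law for the even moments, vanishing odd moments
  have heven : ∀ (f : SchwartzMap (EuclideanSpace ℝ (Fin 3)) ℝ) (m : ℕ),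
      ∫ ω : FieldConfig (EuclideanSpace ℝ (Fin 3)), (ω f) ^ (2 * m) ∂μ =
        ((2 * m)! : ℝ) / (2 ^ m * m !) * V f ^ m := by
    intro f m
    rw [hpow f (2 * m), Newman.integral_gff_even f hΔ0 hΔ3 hA.le m, hV f]
  have hodd : ∀ (f : SchwartzMap (EuclideanSpace ℝ (Fin 3)) ℝ) (m : ℕ),
      ∫ ω : FieldConfig (EuclideanSpace ℝ (Fin 3)), (ω f) ^ (2 * m + 1) ∂μ = 0 := by
    intro f m
    rw [hpow f (2 * m + 1), Newman.integral_gff_odd f Δ A m]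
  -- all exponential moments of a marginal
  have hexpz : ∀ (f : SchwartzMap (EuclideanSpace ℝ (Fin 3)) ℝ) (z : ℝ),
      Integrable (fun ω : FieldConfig (EuclideanSpace ℝ (Fin 3)) => Real.exp (z * ω f)) μ := by
    intro f z
    have h := hexp (z • f)
    simp only [map_smul, smul_eq_mul] at h
    exact h
  -- the moment generating function of a marginal is Gaussian
  have hmgf : ∀ (f : SchwartzMap (EuclideanSpace ℝ (Fin 3)) ℝ) (z : ℝ),
      ∫ ω : FieldConfig (EuclideanSpace ℝ (Fin 3)), Real.exp (z * ω f) ∂μ =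
        Real.exp (V f * z ^ 2 / 2) := by
    intro f z
    have hneg : Integrable (fun ω : FieldConfig (EuclideanSpace ℝ (Fin 3)) =>
        Real.exp (-(z * ω f))) μ := by
      have h := hexpz f (-z)
      simp only [neg_mul] at h
      exact h
    have hVf : ∫ ω : FieldConfig (EuclideanSpace ℝ (Fin 3)), (ω f) ^ 2 ∂μ = V f := rfl
    have h := Literature.MathematicalPhysics.QuantumFieldTheory.abs_mgf_sub_exp_le_of_wickMoment_bounds_of_integrable_exp
      (μ := μ) (X := fun ω : FieldConfig (EuclideanSpace ℝ (Fin 3)) => ω f) (measurable_eval f) z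
      (hexpz f z) hneg (E := 0) (W := 0) le_rfl le_rfl (fun n _ => by
        rw [heven f n, hVf, sub_self, abs_zero]
        positivity) (hodd f)
    rw [hVf, mul_zero, zero_mul, zero_mul, abs_nonpos_iff, sub_eq_zero] at h
    rw [h]
    congr 1
    ring
  -- hence every marginal is a centred Gaussian
  have hmap : ∀ f : SchwartzMap (EuclideanSpace ℝ (Fin 3)) ℝ,
      μ.map (fun ω : FieldConfig (EuclideanSpace ℝ (Fin 3)) => ω f) =
        ProbabilityTheory.gaussianReal 0 (V f).toNNReal := by
    intro f
    haveI : IsProbabilityMeasure (μ.map fun ω : FieldConfig (EuclideanSpace ℝ (Fin 3)) => ω f) :=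
      Measure.isProbabilityMeasure_map (measurable_eval f).aemeasurable
    refine eq_gaussianReal_of_mgf_eq (hV0 f) (fun z => ?_) (fun z => ?_)
    · exact (integrable_map_measure (by fun_prop) (measurable_eval f).aemeasurable).2 (hexpz f z)
    · rw [integral_map (measurable_eval f).aemeasurable (by fun_prop)]
      exact hmgf f z
  refine ⟨Literature.MathematicalPhysics.QuantumFieldTheory.isGaussian_of_map_eval_eq_gaussianReal
    fun f => ⟨0, (V f).toNNReal, hmap f⟩, fun f => ⟨?_, ?_⟩⟩
  · have h := hall 1 f
    rw [ENNReal.coe_one] at h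
    exact memLp_one_iff_integrable.mp h
  · have h := hodd f 0
    simpa using h

end Summit.CriticalPhenomena.Ising3DConformalLimit.Cruxes.GaussianLimitIsFree.Birth

end
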